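/-
Copyright (c) 2026 the pub-hodgecm-mathlib formalisation cell (harness21).  Prover seat hodgecm-mathlib-K2E3-p27 (g0), HCML Track B «K2-LIT» ∕ h413
(`stmt-HodgeConjecture-24833`), line `K2_E3_EllipticInputs`, unit U12 «Characters», PART «RANK» ED. 2 leaf (qs2-sc) of (11-2qs-Id′), census D125 (sc-α): THE SUPERCUSPIDAL
CLASSES OF `U(Φ₂)(L⁺_v)` AT THE IDENTITY ⟸ THE N = 2 INSTANCE OF THE GENERAL-`N` LETTER (SC-an) — a pure REL-tie over ★ generic capital.  2026-09-04.
-/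
import Summits.HodgeConjecture.HodgeConjecture.Theorems.K2E3CharLocIntNearSemisimpleSupercuspidalOfTruncated   -- ★ p856184 (K2E3-p20 g3): `exists_rep_data_of_isSupercuspidal`, `charLocIntNearSemisimple_supercuspidal_of_exists_truncated` (GENERIC `N`)
import Literature.NumberTheory.Automorphic.UnitaryGroupBorelInduction       -- ★ `cmLocalForm L 2 v` (the organ's quasi-split carrier spelling)
import Literature.NumberTheory.Automorphic.LocalUnitaryGroupCongr           -- ★ `antidiagOne_isHermitian`, `isUnit_antidiagOne_det` (`Φ₂` hermitian, unit determinant)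
import HarnessLib

/-!
# Leaf (qs2-sc) `sig_K2E3CharLocIntNearIdentitySupercuspidalQuasiSplitTwo` ⟸ (SC-an) at `N = 2`, `H = Φ₂` (Harish-Chandra 1970 Part VII Thm. 16 for the supercuspidal classes of `U(1,1)`):
# THE REL-TIE (census D125 (sc-α))

Cell `pub/hodgecm-mathlib` (D-0151), Track B «K2-LIT», crux H413 = `stmt-HodgeConjecture-24833`, route `HCCMUnconditional`.  Lane `--supports stmt-HodgeConjecture-24833
--as helper`; THEOREMS ONLY (no `def`, no `instance`, no `notation`, no named-fact hypothesis, no `sorry`); count-neutral.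

THE POINT (census `K2/K2E3-p27/g0/CENSUS-EllipticCorner.K2E3-p27-g0.md` §A).  The U12 MAIN letter (SC-an) `sig_K2E3SupercuspidalTruncatedCharAnalytic` — Harish-Chandra's two estimates
(SC-lim∖ell) ∧ (SC-dom) on the truncated orbital integrals of a supercuspidal coefficient — and its consumer ★ p856184 `charLocIntNearSemisimple_supercuspidal_of_exists_truncated` are
typed for EVERY `N` on `(cmDatum L N H).Local v`; at `N := 2`, `H := Φ₂ = (i, j) ↦ [i + j + 1 = 2]` (hermitian with unit determinant, ★ `antidiagOne_isHermitian`, ★ `isUnit_antidiagOne_det`)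
that carrier IS the organ's quasi-split carrier `G₂ = ↥(unitaryGroupOfForm (conjLocal L c v) (cmLocalForm L 2 v))` (`rfl`: ★ `«local»`, `cmLocalForm` unfold), and row 11 at the point
`s = 1` (semisimple: `toLin' 1 = id`) is the (qs2-sc) leaf.  So (qs2-sc) is NOT an independent corner: it is the `N = 2` instance of the one idle general-`N` letter (SC-an), whose
`N = 3` instance is ★ letter-free (road FC: ★ FC-8∕FC-9∕D56) and whose `N = 2` payment is the «FC₂» port road (census §A.2 (sc-β)).

* HEAD 1 **`charLocIntNearIdentity_supercuspidal_two_of_sigSCan (hSC : ‹(SC-an) VERBATIM, all N›) : ‹(qs2-sc) VERBATIM›`** — docks on MAIN's socket `sig_K2E3SupercuspidalTruncatedCharAnalytic`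
  BY NAME (if the dealer ties (qs2-sc) where MAIN's socket is visible).
* HEAD 2 **`charLocIntNearIdentity_supercuspidal_two_of_sigSCanTwo (hSC₂ : ‹(SC-an) at N := 2, H := Φ₂›) : ‹(qs2-sc) VERBATIM›`** — docks on a PART «RANK» copy «(SC-an)₂» of the
  instance text (one leaf for one leaf, in the currency that has the ★ `N = 3` road as template).
PROOF (= MAIN §SC.2 `charLocIntNearSemisimple_supercuspidal_of_sigSCan` at `N := 2`, `H := Φ₂`, `s := 1`): ★ `exists_rep_data_of_isSupercuspidal` (admissible supercuspidal representative
with an invariant positive-definite Hermitian form), a non-zero vector, the letter, ★ `charLocIntNearSemisimple_supercuspidal_of_exists_truncated` at the semisimple point `1`.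

HONEST LABEL: HC_CM is proved only modulo the 7 printed citations (2 remaining named inputs: hLiu418 = stmt-HodgeConjecture-24832, h413 = stmt-HodgeConjecture-24833) until rung 0
closes; count-neutral helper; after the dealer's tie (qs2-sc) is REL over EXACTLY the (SC-an) letter at `N = 2` (REL ≠ ★); Harish-Chandra's estimates themselves are NOT proved here.

## References
* [HarishChandra1970] Harish-Chandra (notes by G. van Dijk), *Harmonic Analysis on Reductive p-adic Groups*, LNM 162 (1970), Part VII §3 Thm. 16 p. 67, pp. 70–73; Thms 14–15,
  18–20.
* [HarishChandra1999] Harish-Chandra (notes by S. DeBacker, P. J. Sally, Jr.), *Admissible Invariant Distributions on Reductive p-adic Groups*, AMS ULS 16 (1999), Thm. 16.1 p. 77.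
* [Rogawski1990] J. D. Rogawski, *Automorphic Representations of Unitary Groups in Three Variables*, Ann. of Math. Stud. 123 (1990), §1.9 p. 13, §12.2 p. 173.
-/

set_option autoImplicit false
set_option linter.dupNamespace false

noncomputable section

open MeasureTheory Filter Topology NumberField IsDedekindDomain
open scoped NNReal ENNReal Matrix MatrixGroups
open Literature.NumberTheory.Rogawski1990 Literature.NumberTheory.Automorphic Literature.NumberTheory.Automorphic.UnitaryGroup
open Literature.NumberTheory.GaloisRepresentations Literature.NumberTheory.GaloisRepresentations.IsNonarchimedeanLocalField
open Summit.HodgeConjecture.HodgeConjecture.Cruxes.H413.K2E3CharLocIntNearSemisimpleSupercuspidalOfTruncated (exists_rep_data_of_isSupercuspidal charLocIntNearSemisimple_supercuspidal_of_exists_truncated)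

namespace Summit.HodgeConjecture.HodgeConjecture.Cruxes.H413.K2E3CharLocIntNearIdentitySupercuspidalTwoOfSCan

/-- The identity of `U(Φ₂)(L⁺_v)` is semisimple (`toLin' 1 = id`). [folklore] -/
theorem isSemisimple_toLin'_one (L : Type) [Field L] [NumberField L] [IsCMField L] (v : HeightOneSpectrum (𝓞 ↥(maximalRealSubfield L))) :
    Module.End.IsSemisimple (Matrix.toLin' (((1 : ↥(unitaryGroupOfForm (conjLocal L (IsCMField.complexConj L) v) (cmLocalForm L 2 v))).val : GL (Fin 2) (UnitaryGroup.LocalRing L v)).val :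
      Matrix (Fin 2) (Fin 2) (UnitaryGroup.LocalRing L v))) := by
  rw [show (((1 : ↥(unitaryGroupOfForm (conjLocal L (IsCMField.complexConj L) v) (cmLocalForm L 2 v))).val : GL (Fin 2) (UnitaryGroup.LocalRing L v)).val :
      Matrix (Fin 2) (Fin 2) (UnitaryGroup.LocalRing L v)) = 1 from rfl, Matrix.toLin'_one]
  exact Module.End.isSemisimple_id

set_option maxHeartbeats 1600000 in
-- long binder lists (the ∀-closed letter as an antecedent) read on two spellings of one carrier
/-- **HEAD 1 — (qs2-sc) ⟸ (SC-an), the general-`N` letter VERBATIM** (U12 MAIN `sig_K2E3SupercuspidalTruncatedCharAnalytic`), instantiated inside at `N := 2`, `H := Φ₂`, `s := 1`.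
[cite: HarishChandra1970, Part VII §3 Thm. 16 p. 67] [cite: HarishChandra1999, Thm. 16.1 p. 77] [cite: Rogawski1990, §12.2 p. 173] -/
theorem charLocIntNearIdentity_supercuspidal_two_of_sigSCan
    (hSC :   ∀ (L : Type) [Field L] [NumberField L] [IsCMField L] (N : ℕ) (H : Matrix (Fin N) (Fin N) L),
    (H.map (cmConjRingHom L))ᵀ = H → H.det ≠ 0 →
    ∀ (v : HeightOneSpectrum (𝓞 ↥(maximalRealSubfield L))),
      (∀ w : PlacesOver L v, IsCMField.complexConj L • w.1 = w.1) →
    ∀ [MeasurableSpace ((UnitaryGroup.cmDatum L N H).Local v)] [BorelSpace ((UnitaryGroup.cmDatum L N H).Local v)]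
      (μ : Measure ((UnitaryGroup.cmDatum L N H).Local v)) [μ.IsHaarMeasure]
      (r : SmoothIrrep ((UnitaryGroup.cmDatum L N H).Local v)), r.ρ.IsSupercuspidal →
    ∀ (B : r.V →ₗ⋆[ℂ] r.V →ₗ[ℂ] ℂ), B.IsSymm → (∀ x : r.V, x ≠ 0 → 0 < (B x x).re) →
      (∀ (g : (UnitaryGroup.cmDatum L N H).Local v) (x y : r.V), B (r.ρ g x) (r.ρ g y) = B x y) →
    ∀ (v₁ : r.V), v₁ ≠ 0 →
      ∃ (Ω : CompactExhaustion ((UnitaryGroup.cmDatum L N H).Local v))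
        (F : (UnitaryGroup.cmDatum L N H).Local v → ℂ) (M : (UnitaryGroup.cmDatum L N H).Local v → ℝ),
        (∀ᵐ g ∂μ, ¬ (IsRegularElt (g.val : GL (Fin N) (UnitaryGroup.LocalRing L v)) ∧
            IsCompact ((Subgroup.centralizer ({g} : Set ((UnitaryGroup.cmDatum L N H).Local v))) : Set ((UnitaryGroup.cmDatum L N H).Local v))) →
          Tendsto (fun n => ∫ x in Ω n, B v₁ (r.ρ (x * g * x⁻¹) v₁) ∂μ) atTop (𝓝 (F g))) ∧
        (∀ n : ℕ, ∀ᵐ g ∂μ, ‖∫ x in Ω n, B v₁ (r.ρ (x * g * x⁻¹) v₁) ∂μ‖ ≤ M g) ∧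
        LocallyIntegrable M μ) :
    ∀ (L : Type) [Field L] [NumberField L] [IsCMField L] (v : HeightOneSpectrum (𝓞 ↥(maximalRealSubfield L))),
      (∀ w : PlacesOver L v, IsCMField.complexConj L • w.1 = w.1) →
      ∀ [MeasurableSpace ↥(unitaryGroupOfForm (conjLocal L (IsCMField.complexConj L) v) (cmLocalForm L 2 v))] [BorelSpace ↥(unitaryGroupOfForm (conjLocal L (IsCMField.complexConj L) v) (cmLocalForm L 2 v))]
        (μ : Measure ↥(unitaryGroupOfForm (conjLocal L (IsCMField.complexConj L) v) (cmLocalForm L 2 v))) [μ.IsHaarMeasure] (c : IrrClass ↥(unitaryGroupOfForm (conjLocal L (IsCMField.complexConj L) v) (cmLocalForm L 2 v))), c.IsSupercuspidal →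
        ∃ U : Set ↥(unitaryGroupOfForm (conjLocal L (IsCMField.complexConj L) v) (cmLocalForm L 2 v)), IsOpen U ∧ (1 : ↥(unitaryGroupOfForm (conjLocal L (IsCMField.complexConj L) v) (cmLocalForm L 2 v))) ∈ U ∧
          ∃ Θ : ↥(unitaryGroupOfForm (conjLocal L (IsCMField.complexConj L) v) (cmLocalForm L 2 v)) → ℂ, IntegrableOn Θ U μ ∧
            ∀ f : ↥(unitaryGroupOfForm (conjLocal L (IsCMField.complexConj L) v) (cmLocalForm L 2 v)) → ℂ, f ∈ SchwartzBruhat ↥(unitaryGroupOfForm (conjLocal L (IsCMField.complexConj L) v) (cmLocalForm L 2 v)) →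
              tsupport f ⊆ U → c.smoothTrace μ f = ∫ g, f g * Θ g ∂μ := by
  intro L _ _ _ v hns instM instB μ instH c hsc
  -- the organ carrier `G₂` IS `(cmDatum L 2 Φ₂).Local v` (`rfl`); hand its Borel structure and Haar measure to the `cmDatum` spelling
  letI : MeasurableSpace ((UnitaryGroup.cmDatum L 2 (Matrix.of fun i j : Fin 2 => if i.val + j.val + 1 = 2 then (1 : L) else 0)).Local v) := instM
  haveI : BorelSpace ((UnitaryGroup.cmDatum L 2 (Matrix.of fun i j : Fin 2 => if i.val + j.val + 1 = 2 then (1 : L) else 0)).Local v) := instB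
  haveI : Measure.IsHaarMeasure (G := (UnitaryGroup.cmDatum L 2 (Matrix.of fun i j : Fin 2 => if i.val + j.val + 1 = 2 then (1 : L) else 0)).Local v) μ := instH
  have hH := UnitaryGroup.antidiagOne_isHermitian L 2
  have hdet : (Matrix.of fun i j : Fin 2 => if i.val + j.val + 1 = 2 then (1 : L) else 0).det ≠ 0 := (UnitaryGroup.isUnit_antidiagOne_det L 2).ne_zero
  obtain ⟨r, hr, hsc', -, B, hBsymm, hBpos, hBinv⟩ :=
    exists_rep_data_of_isSupercuspidal L 2 (Matrix.of fun i j : Fin 2 => if i.val + j.val + 1 = 2 then (1 : L) else 0) hH hdet v hns c hsc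
  haveI : r.ρ.IsIrreducible := r.isIrreducible
  haveI : Nontrivial r.V := Representation.IsIrreducible.nontrivial r.ρ
  obtain ⟨v₁, hv₁⟩ := exists_ne (0 : r.V)
  obtain ⟨Ω, F, M, hlim, hdom, hM⟩ :=
    hSC L 2 (Matrix.of fun i j : Fin 2 => if i.val + j.val + 1 = 2 then (1 : L) else 0) hH hdet v hns μ r hsc' B hBsymm hBpos hBinv v₁ hv₁
  exact charLocIntNearSemisimple_supercuspidal_of_exists_truncated L 2 (Matrix.of fun i j : Fin 2 => if i.val + j.val + 1 = 2 then (1 : L) else 0) hH hdet v hns μ c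
    ⟨r, hr, hsc', B, hBsymm, hBpos, hBinv, v₁, hv₁, Ω, F, M, hlim, hdom, hM⟩ 1 (isSemisimple_toLin'_one L v)

set_option maxHeartbeats 1600000 in
-- long binder lists (the ∀-closed letter as an antecedent) read on two spellings of one carrier
/-- **HEAD 2 — (qs2-sc) ⟸ (SC-an)₂, the `N := 2`, `H := Φ₂` INSTANCE of the letter** (the text a PART «RANK» leaf «(SC-an)₂» would carry: MAIN's (SC-an) text with the binders
`(N) (H)` and the two form hypotheses dropped, `N ↦ 2`, `H ↦ Φ₂`). [cite: HarishChandra1970, Part VII §3 Thm. 16 p. 67] [cite: HarishChandra1999, Thm. 16.1 p. 77] -/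
theorem charLocIntNearIdentity_supercuspidal_two_of_sigSCanTwo
    (hSC₂ :   ∀ (L : Type) [Field L] [NumberField L] [IsCMField L] (v : HeightOneSpectrum (𝓞 ↥(maximalRealSubfield L))),
      (∀ w : PlacesOver L v, IsCMField.complexConj L • w.1 = w.1) →
    ∀ [MeasurableSpace ((UnitaryGroup.cmDatum L 2 (Matrix.of fun i j : Fin 2 => if i.val + j.val + 1 = 2 then (1 : L) else 0)).Local v)] [BorelSpace ((UnitaryGroup.cmDatum L 2 (Matrix.of fun i j : Fin 2 => if i.val + j.val + 1 = 2 then (1 : L) else 0)).Local v)]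
      (μ : Measure ((UnitaryGroup.cmDatum L 2 (Matrix.of fun i j : Fin 2 => if i.val + j.val + 1 = 2 then (1 : L) else 0)).Local v)) [μ.IsHaarMeasure]
      (r : SmoothIrrep ((UnitaryGroup.cmDatum L 2 (Matrix.of fun i j : Fin 2 => if i.val + j.val + 1 = 2 then (1 : L) else 0)).Local v)), r.ρ.IsSupercuspidal →
    ∀ (B : r.V →ₗ⋆[ℂ] r.V →ₗ[ℂ] ℂ), B.IsSymm → (∀ x : r.V, x ≠ 0 → 0 < (B x x).re) →
      (∀ (g : (UnitaryGroup.cmDatum L 2 (Matrix.of fun i j : Fin 2 => if i.val + j.val + 1 = 2 then (1 : L) else 0)).Local v) (x y : r.V), B (r.ρ g x) (r.ρ g y) = B x y) →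
    ∀ (v₁ : r.V), v₁ ≠ 0 →
      ∃ (Ω : CompactExhaustion ((UnitaryGroup.cmDatum L 2 (Matrix.of fun i j : Fin 2 => if i.val + j.val + 1 = 2 then (1 : L) else 0)).Local v))
        (F : (UnitaryGroup.cmDatum L 2 (Matrix.of fun i j : Fin 2 => if i.val + j.val + 1 = 2 then (1 : L) else 0)).Local v → ℂ) (M : (UnitaryGroup.cmDatum L 2 (Matrix.of fun i j : Fin 2 => if i.val + j.val + 1 = 2 then (1 : L) else 0)).Local v → ℝ),
        (∀ᵐ g ∂μ, ¬ (IsRegularElt (g.val : GL (Fin 2) (UnitaryGroup.LocalRing L v)) ∧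
            IsCompact ((Subgroup.centralizer ({g} : Set ((UnitaryGroup.cmDatum L 2 (Matrix.of fun i j : Fin 2 => if i.val + j.val + 1 = 2 then (1 : L) else 0)).Local v))) : Set ((UnitaryGroup.cmDatum L 2 (Matrix.of fun i j : Fin 2 => if i.val + j.val + 1 = 2 then (1 : L) else 0)).Local v))) →
          Tendsto (fun n => ∫ x in Ω n, B v₁ (r.ρ (x * g * x⁻¹) v₁) ∂μ) atTop (𝓝 (F g))) ∧
        (∀ n : ℕ, ∀ᵐ g ∂μ, ‖∫ x in Ω n, B v₁ (r.ρ (x * g * x⁻¹) v₁) ∂μ‖ ≤ M g) ∧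
        LocallyIntegrable M μ) :
    ∀ (L : Type) [Field L] [NumberField L] [IsCMField L] (v : HeightOneSpectrum (𝓞 ↥(maximalRealSubfield L))),
      (∀ w : PlacesOver L v, IsCMField.complexConj L • w.1 = w.1) →
      ∀ [MeasurableSpace ↥(unitaryGroupOfForm (conjLocal L (IsCMField.complexConj L) v) (cmLocalForm L 2 v))] [BorelSpace ↥(unitaryGroupOfForm (conjLocal L (IsCMField.complexConj L) v) (cmLocalForm L 2 v))]
        (μ : Measure ↥(unitaryGroupOfForm (conjLocal L (IsCMField.complexConj L) v) (cmLocalForm L 2 v))) [μ.IsHaarMeasure] (c : IrrClass ↥(unitaryGroupOfForm (conjLocal L (IsCMField.complexConj L) v) (cmLocalForm L 2 v))), c.IsSupercuspidal →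
        ∃ U : Set ↥(unitaryGroupOfForm (conjLocal L (IsCMField.complexConj L) v) (cmLocalForm L 2 v)), IsOpen U ∧ (1 : ↥(unitaryGroupOfForm (conjLocal L (IsCMField.complexConj L) v) (cmLocalForm L 2 v))) ∈ U ∧
          ∃ Θ : ↥(unitaryGroupOfForm (conjLocal L (IsCMField.complexConj L) v) (cmLocalForm L 2 v)) → ℂ, IntegrableOn Θ U μ ∧
            ∀ f : ↥(unitaryGroupOfForm (conjLocal L (IsCMField.complexConj L) v) (cmLocalForm L 2 v)) → ℂ, f ∈ SchwartzBruhat ↥(unitaryGroupOfForm (conjLocal L (IsCMField.complexConj L) v) (cmLocalForm L 2 v)) →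
              tsupport f ⊆ U → c.smoothTrace μ f = ∫ g, f g * Θ g ∂μ := by
  intro L _ _ _ v hns instM instB μ instH c hsc
  -- the organ carrier `G₂` IS `(cmDatum L 2 Φ₂).Local v` (`rfl`); hand its Borel structure and Haar measure to the `cmDatum` spelling
  letI : MeasurableSpace ((UnitaryGroup.cmDatum L 2 (Matrix.of fun i j : Fin 2 => if i.val + j.val + 1 = 2 then (1 : L) else 0)).Local v) := instM
  haveI : BorelSpace ((UnitaryGroup.cmDatum L 2 (Matrix.of fun i j : Fin 2 => if i.val + j.val + 1 = 2 then (1 : L) else 0)).Local v) := instB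
  haveI : Measure.IsHaarMeasure (G := (UnitaryGroup.cmDatum L 2 (Matrix.of fun i j : Fin 2 => if i.val + j.val + 1 = 2 then (1 : L) else 0)).Local v) μ := instH
  have hH := UnitaryGroup.antidiagOne_isHermitian L 2
  have hdet : (Matrix.of fun i j : Fin 2 => if i.val + j.val + 1 = 2 then (1 : L) else 0).det ≠ 0 := (UnitaryGroup.isUnit_antidiagOne_det L 2).ne_zero
  obtain ⟨r, hr, hsc', -, B, hBsymm, hBpos, hBinv⟩ :=
    exists_rep_data_of_isSupercuspidal L 2 (Matrix.of fun i j : Fin 2 => if i.val + j.val + 1 = 2 then (1 : L) else 0) hH hdet v hns c hsc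
  haveI : r.ρ.IsIrreducible := r.isIrreducible
  haveI : Nontrivial r.V := Representation.IsIrreducible.nontrivial r.ρ
  obtain ⟨v₁, hv₁⟩ := exists_ne (0 : r.V)
  obtain ⟨Ω, F, M, hlim, hdom, hM⟩ := hSC₂ L v hns μ r hsc' B hBsymm hBpos hBinv v₁ hv₁
  exact charLocIntNearSemisimple_supercuspidal_of_exists_truncated L 2 (Matrix.of fun i j : Fin 2 => if i.val + j.val + 1 = 2 then (1 : L) else 0) hH hdet v hns μ c
    ⟨r, hr, hsc', B, hBsymm, hBpos, hBinv, v₁, hv₁, Ω, F, M, hlim, hdom, hM⟩ 1 (isSemisimple_toLin'_one L v)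

end Summit.HodgeConjecture.HodgeConjecture.Cruxes.H413.K2E3CharLocIntNearIdentitySupercuspidalTwoOfSCan

end
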